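import Mathlib
import Summits.Ventures.PercRepro2.Independence
import Summits.Ventures.PercRepro2.Harris
import Summits.Ventures.PercRepro2.HCov
import Summits.Ventures.PercRepro2.CycleTheorem
import Summits.Ventures.PercRepro2.BlockSubstConn

/-!
# Block substitution: the law of the pattern and the transport of (HCOV) to the skeleton
(blind cell PercRepro2, mine-2 g33)

For a block substitution (`IsBlockSubst`, `BlockSubstConn.lean`) the block weights `bsProb p j`
are the probabilities that block `j` connects its two terminals inside itself.

* **`prob_bsOpen_preimage`**: the law of the pattern `bsOpen` is the product law of the block
  weights (the blocks are disjoint edge sets, `prob_inter_eq_mul_of_dependsOn`);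
* **`Gc_blockSubst`**: the covariance form of the graph at terminal marks is the covariance form
  of the skeleton at the block weights — with `conn_marks_iff_bs` the form transports along the
  pattern (`Cycle.Gc_transport'`);
* **`HCov_blockSubst`** / **`HCov_of_skeleton`**: (HCOV) on the skeleton (at the block weights,
  resp. for every admissible weight vector) gives (HCOV) on the graph — **(HCOV) is invariant under
  replacing the edges of a skeleton by mark-free two-terminal blocks**; `ZDelta_blockSubst` is the
  crux of record under `P(a₁ ↔ b) ≤ P(a₂ ↔ b)`.

typer-1 g48's necklace law (`CycleNecklace.lean`, skeleton `C₅`) with the skeleton freed.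

(v2: the declarations of the accepted v1 byte for byte; re-filed because the farm served no olean
of v1 for 16 minutes while later landings were served.)
-/

namespace Summit.Ventures.PercRepro2

namespace BlockSubst

section Law

variable {V : Type*} {E : Type*} {V' : Type*} {E' : Type*} [Fintype E] [DecidableEq E]
  [Fintype E'] [DecidableEq E']
variable {ends : E → Sym2 V} {ends' : E' → Sym2 V'} {q : V' → V} {blk : E → E'} {Vj : E' → Set V}

/-! ### The law of the block pattern -/

variable {R : Type*} [Field R]

/-- The block weights: the probability that block `j` connects its terminals inside itself. -/
noncomputable def bsProb (ends : E → Sym2 V) (ends' : E' → Sym2 V') (q : V' → V) (blk : E → E')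
    (p : E → R) (j : E') : R :=
  prob p {ω | bsOpen ends ends' q blk ω j = true}

omit [Fintype E'] in
/-- The block weights are admissible. -/
lemma isProbVec_bsProb [LinearOrder R] [IsStrictOrderedRing R] {p : E → R} (hp : IsProbVec p) :
    IsProbVec (bsProb ends ends' q blk p) where
  nonneg _ := prob_nonneg hp _
  le_one _ := prob_le_one hp _

/-- The event `{bsOpen ω j = σ j}`. -/
def bsEvent (ends : E → Sym2 V) (ends' : E' → Sym2 V') (q : V' → V) (blk : E → E')
    (σ : Config E') (j : E') : Set (Config E) :=
  {ω | bsOpen ends ends' q blk ω j = σ j}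

omit [Fintype E] [DecidableEq E] [Fintype E'] in
/-- `{bsOpen ω j = σ j}` is determined by the edges of block `j`. -/
lemma dependsOn_bsEvent (σ : Config E') (j : E') :
    DependsOn (· ∈ bsEvent ends ends' q blk σ j) {e | blk e = j} := by
  intro ω ω' h
  simp only [bsEvent, Set.mem_setOf_eq, bsOpen]
  rw [blockCfg_congr h]

omit [Fintype E'] in
/-- The probability that block `j` shows the state `σ j`. -/
lemma prob_bsEvent (p : E → R) (σ : Config E') (j : E') :
    prob p (bsEvent ends ends' q blk σ j) = edgeFactor (bsProb ends ends' q blk p j) (σ j) := by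
  cases hσ : σ j
  · have : bsEvent ends ends' q blk σ j = {ω | bsOpen ends ends' q blk ω j = true}ᶜ := by
      ext ω
      simp only [bsEvent, Set.mem_setOf_eq, hσ, Set.mem_compl_iff, Bool.not_eq_true]
    rw [this, prob_compl]
    rfl
  · have : bsEvent ends ends' q blk σ j = {ω | bsOpen ends ends' q blk ω j = true} := by
      ext ω
      simp only [bsEvent, Set.mem_setOf_eq, hσ]
    rw [this]
    rfl

omit [Fintype E'] in
/-- **Independence of the blocks**: the probability of a conjunction of block events over a set
of blocks is the product. -/
lemma prob_biInter_bsEvent (p : E → R) (σ : Config E') (s : Finset E') :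
    prob p (⋂ j ∈ s, bsEvent ends ends' q blk σ j) =
        ∏ j ∈ s, prob p (bsEvent ends ends' q blk σ j) ∧
      DependsOn (· ∈ ⋂ j ∈ s, bsEvent ends ends' q blk σ j) {e | blk e ∈ s} := by
  induction s using Finset.induction_on with
  | empty =>
    refine ⟨by simp, ?_⟩
    intro ω ω' _
    simp
  | insert j s hj ih =>
    obtain ⟨ih1, ih2⟩ := ih
    have hdisj : Disjoint {e | blk e = j} {e | blk e ∈ s} := by
      rw [Set.disjoint_left]
      intro e he he'
      simp only [Set.mem_setOf_eq] at he he'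
      exact hj (he ▸ he')
    rw [Finset.set_biInter_insert]
    refine ⟨?_, ?_⟩
    · rw [prob_inter_eq_mul_of_dependsOn p hdisj
        (dependsOn_bsEvent (ends := ends) (ends' := ends') (q := q) (blk := blk) σ j) ih2, ih1,
        Finset.prod_insert hj]
    · have := dependsOn_inter
        (dependsOn_bsEvent (ends := ends) (ends' := ends') (q := q) (blk := blk) σ j) ih2
      have hset : ({e | blk e = j} ∪ {e | blk e ∈ s} : Set E) = {e | blk e ∈ insert j s} := by
        ext e
        simp [Finset.mem_insert]
      rwa [hset] at this

omit [Fintype E] [DecidableEq E] in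
/-- The fibre of the pattern is the conjunction of the block events. -/
lemma bsOpen_fibre_eq (σ : Config E') :
    {ω : Config E | bsOpen ends ends' q blk ω = σ} =
      ⋂ j ∈ (Finset.univ : Finset E'), bsEvent ends ends' q blk σ j := by
  ext ω
  simp only [Set.mem_setOf_eq, Set.mem_iInter, Finset.mem_univ, bsEvent, true_implies]
  exact ⟨fun h j => by rw [h], fun h => funext h⟩

/-- **The law of the block pattern is the product law of the block weights.** -/
theorem prob_bsOpen_eq (p : E → R) (σ : Config E') :
    prob p {ω | bsOpen ends ends' q blk ω = σ} = weight (bsProb ends ends' q blk p) σ := by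
  rw [bsOpen_fibre_eq, (prob_biInter_bsEvent p σ Finset.univ).1]
  unfold weight
  exact Finset.prod_congr rfl fun j _ => prob_bsEvent p σ j

/-- **Pushforward**: the probability of a pattern event in the graph is its probability in the
skeleton at the block weights. -/
theorem prob_bsOpen_preimage (p : E → R) (A : Set (Config E')) :
    prob p (bsOpen ends ends' q blk ⁻¹' A) = prob (bsProb ends ends' q blk p) A := by
  classical
  calc prob p (bsOpen ends ends' q blk ⁻¹' A)
      = ∑ ω, (bsOpen ends ends' q blk ⁻¹' A).indicator (weight p) ω := rfl
    _ = ∑ σ, ∑ ω ∈ Finset.univ.filter (fun ω => bsOpen ends ends' q blk ω = σ),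
          (bsOpen ends ends' q blk ⁻¹' A).indicator (weight p) ω :=
        (Finset.sum_fiberwise Finset.univ (bsOpen ends ends' q blk) _).symm
    _ = ∑ σ, A.indicator (fun σ => prob p {ω | bsOpen ends ends' q blk ω = σ}) σ := by
        refine Finset.sum_congr rfl fun σ _ => ?_
        by_cases hA : σ ∈ A
        · rw [Set.indicator_of_mem hA]
          unfold prob
          rw [Finset.sum_filter]
          refine Finset.sum_congr rfl fun ω _ => ?_
          by_cases hω : bsOpen ends ends' q blk ω = σ
          · rw [if_pos hω,
              Set.indicator_of_mem (show ω ∈ {ω | bsOpen ends ends' q blk ω = σ} from hω),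
              Set.indicator_of_mem (show ω ∈ bsOpen ends ends' q blk ⁻¹' A from by
                rw [Set.mem_preimage, hω]; exact hA)]
          · rw [if_neg hω,
              Set.indicator_of_notMem (show ω ∉ {ω | bsOpen ends ends' q blk ω = σ} from hω)]
        · rw [Set.indicator_of_notMem hA]
          refine Finset.sum_eq_zero fun ω hω => ?_
          rw [Finset.mem_filter] at hω
          rw [Set.indicator_of_notMem]
          rw [Set.mem_preimage, hω.2]
          exact hA
    _ = ∑ σ, A.indicator (weight (bsProb ends ends' q blk p)) σ := by
        refine Finset.sum_congr rfl fun σ _ => ?_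
        by_cases hA : σ ∈ A
        · rw [Set.indicator_of_mem hA, Set.indicator_of_mem hA, prob_bsOpen_eq]
        · rw [Set.indicator_of_notMem hA, Set.indicator_of_notMem hA]
    _ = prob (bsProb ends ends' q blk p) A := rfl

/-! ### The transport of the covariance form and of (HCOV) -/

/-- **The covariance form transports to the skeleton**: `Gc` of the graph at terminal marks is
`Gc` of the skeleton at the block weights (`conn_marks_iff_bs` + `prob_bsOpen_preimage` through
`Cycle.Gc_transport'`). -/
theorem Gc_blockSubst (hB : IsBlockSubst ends ends' q blk Vj) (p : E → R) (o a₁ a₂ a₃ b : V') :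
    CovForm.Gc p ends (q o) (q a₁) (q a₂) (q a₃) (q b) =
      CovForm.Gc (bsProb ends ends' q blk p) ends' o a₁ a₂ a₃ b :=
  (Cycle.Gc_transport' (fun A => (prob_bsOpen_preimage p A).symm)
    (fun ω x z => (conn_marks_iff_bs hB ω x z).symm) o a₁ a₂ a₃ b).symm

variable [LinearOrder R] [IsStrictOrderedRing R]

omit [IsStrictOrderedRing R] in
/-- **(HCOV) descends from the skeleton**: (HCOV) on the skeleton at the block weights gives
(HCOV) on the graph at the terminal marks. -/
theorem HCov_blockSubst (hB : IsBlockSubst ends ends' q blk Vj) (p : E → R) (o a₁ a₂ a₃ b : V')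
    (h : CovForm.HCov (bsProb ends ends' q blk p) ends' o a₁ a₂ a₃ b) :
    CovForm.HCov p ends (q o) (q a₁) (q a₂) (q a₃) (q b) := by
  unfold CovForm.HCov
  rw [Gc_blockSubst hB p o a₁ a₂ a₃ b]
  exact h

/-- **(HCOV) is invariant under block substitution**: if the skeleton satisfies (HCOV) at the
marks for every admissible weight vector, so does every block substitution of it, for every
admissible weight vector. -/
theorem HCov_of_skeleton (hB : IsBlockSubst ends ends' q blk Vj) (o a₁ a₂ a₃ b : V')
    (hsk : ∀ r : E' → R, IsProbVec r → CovForm.HCov r ends' o a₁ a₂ a₃ b) (p : E → R)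
    (hp : IsProbVec p) : CovForm.HCov p ends (q o) (q a₁) (q a₂) (q a₃) (q b) :=
  HCov_blockSubst hB p o a₁ a₂ a₃ b (hsk _ (isProbVec_bsProb hp))

/-- **The crux of record on a block substitution** under `P(a₁ ↔ b) ≤ P(a₂ ↔ b)`, from (HCOV) on
the skeleton for every admissible weight vector. -/
theorem ZDelta_blockSubst [Fintype V] [DecidableEq V] (hB : IsBlockSubst ends ends' q blk Vj)
    (o a₁ a₂ a₃ b : V') (hsk : ∀ r : E' → R, IsProbVec r → CovForm.HCov r ends' o a₁ a₂ a₃ b)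
    (p : E → R) (hp : IsProbVec p)
    (hord : prob p (connEvent ends (q a₁) (q b)) ≤ prob p (connEvent ends (q a₂) (q b))) :
    ZDelta p ends (q o) (q a₁) (q a₂) (q a₃) (q b) :=
  CovForm.ZDelta_of_HCov p hp ends hord (HCov_of_skeleton hB o a₁ a₂ a₃ b hsk p hp)

end Law

end BlockSubst

end Summit.Ventures.PercRepro2
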